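import Summits.QuantumAdvantage.QuantumAdvantage.Theorems.LinnikCubicClassGroupsDegreeOnePrimesEscapeClassPNTOfDensityEps
import Summits.QuantumAdvantage.QuantumAdvantage.Theorems.LinnikCubicClassGroupsDegreeOnePrimesEscapeClassPNTFamilyDensity
import Summits.QuantumAdvantage.QuantumAdvantage.Theorems.LinnikCubicClassGroupsDegreeOnePrimesEscapeResidueBound
import Literature.NumberTheory.QuadraticFields.RealQuadraticRegulatorLowerBound
import HarnessLib

/-!
# The additive class prime number theorem, XI: relative error `ε`, `κ`-form and unconditional discharges

Topic `Summits/QuantumAdvantage/QuantumAdvantage/Theorems`, cell B2b-1 (linnik-cubic), PART A, the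
`stub_classPNTAdditive` slice of the crux `DegreeOnePrimesEscape` (stmt-QuantumAdvantage-11543) of route
`LinnikCubicClassGroups`, in DEGREE-LOCAL form.  HONEST FRAMING: the value of this file is a THEOREM
(kernel-checked) — NOT summit progress.

The `ε`-versions of file VIII/IX: for every `ε > 0` the per-class prime ideal theorem
`|π_C(x) − Li(x)/h| ≤ ε Li(x)/h` (`x ≥ Q^{c₁(ε)}`), or the same with the exceptional main term
`Li(x) − Re χ₁(C) Li(x^{β₁})` for the (at most one) real zero `β₁ ∈ (1 − 1/(8 log Q), 1)` of a real class
group character — GRH-free and Siegel-free (the exceptional zero is kept, not excluded):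

* `classPNTAdditive_eps_of_kappa_local (n) (A) (ε)` — fields of degree `n > 1` with `κ_K ≥ Q^{−A}`;
* `classPNTAdditive_eps_three (ε)` — every cubic field;  `classPNTAdditive_eps_quadratic (ε)` — every
  quadratic field;  `classPNTAdditive_eps_of_noQuadraticSubfield (n) (ε)`;  `classPNTAdditive_eps_of_le_three`
  — every number field of degree `2` or `3`.
-/

noncomputable section

open Complex Real MeasureTheory Set Filter Topology
open scoped NumberField nonZeroDivisors

namespace Summit.QuantumAdvantage.QuantumAdvantage.Theorems.DegreeOnePrimesEscape

open Literature.NumberTheory.LFunctions Literature.NumberTheory.LFunctions.NumberField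
  Literature.NumberTheory.LFunctions.AbelianDensity Literature.NumberTheory.QuadraticFields

/-- **`ε`-form, `κ`-hypothesis, one degree**: for `n > 1`, real `A` and `ε > 0` there is `c₁ > 0` such that
every number field `K` of degree `n` with `κ_K ≥ Q^{−A}` satisfies, for every class `C` and `x ≥ Q^{c₁}`,
`|π_C(x) − Li(x)/h| ≤ ε Li(x)/h`, or the exceptional alternative with the same error. -/
theorem classPNTAdditive_eps_of_kappa_local (n : ℕ) (hn : 1 < n) (A : ℝ) {ε : ℝ} (hε : 0 < ε) :
    ∃ c₁ : ℝ, 0 < c₁ ∧ ∀ (K : Type) [Field K] [NumberField K], Module.finrank ℚ K = n →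
      ThornerZaman.condQn K ^ (-A) ≤ NumberField.dedekindZeta_residue K →
      ((∀ (C : ClassGroup (𝓞 K)) (x : ℝ), ThornerZaman.condQn K ^ c₁ ≤ x →
          |(primeIdealClassCount K C x : ℝ) - offsetLogIntegral x / NumberField.classNumber K| ≤
            ε * offsetLogIntegral x / NumberField.classNumber K) ∨
        ∃ (χ₁ : ClassGroup (𝓞 K) →* ℂˣ) (β₁ : ℝ), χ₁ * χ₁ = 1 ∧
          1 - 1 / (8 * Real.log (ThornerZaman.condQn K)) < β₁ ∧ β₁ < 1 ∧
          classGroupLFunction K χ₁ β₁ = 0 ∧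
          ∀ (C : ClassGroup (𝓞 K)) (x : ℝ), ThornerZaman.condQn K ^ c₁ ≤ x →
            |(primeIdealClassCount K C x : ℝ) -
                (offsetLogIntegral x - ((χ₁ C : ℂ)).re * offsetLogIntegral (x ^ β₁)) /
                  NumberField.classNumber K| ≤
              ε * offsetLogIntegral x / NumberField.classNumber K) := by
  obtain ⟨b, D, hb, hD, hdens⟩ := fam_density_local n hn A
  have ha : (1 : ℝ) ≤ max A 4 := le_trans (by norm_num) (le_max_right _ _)
  obtain ⟨c₁, hc₁, h⟩ := classPNTAdditive_of_famDensity_eps n hn hb hD ha hε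
  exact ⟨c₁, hc₁, fun K _ _ hKn hκ ↦ h K hKn (hdens K hKn hκ)⟩

/-- **`ε`-form for every CUBIC field, unconditional.** -/
theorem classPNTAdditive_eps_three {ε : ℝ} (hε : 0 < ε) :
    ∃ c₁ : ℝ, 0 < c₁ ∧ ∀ (K : Type) [Field K] [NumberField K], Module.finrank ℚ K = 3 →
      ((∀ (C : ClassGroup (𝓞 K)) (x : ℝ), ThornerZaman.condQn K ^ c₁ ≤ x →
          |(primeIdealClassCount K C x : ℝ) - offsetLogIntegral x / NumberField.classNumber K| ≤
            ε * offsetLogIntegral x / NumberField.classNumber K) ∨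
        ∃ (χ₁ : ClassGroup (𝓞 K) →* ℂˣ) (β₁ : ℝ), χ₁ * χ₁ = 1 ∧
          1 - 1 / (8 * Real.log (ThornerZaman.condQn K)) < β₁ ∧ β₁ < 1 ∧
          classGroupLFunction K χ₁ β₁ = 0 ∧
          ∀ (C : ClassGroup (𝓞 K)) (x : ℝ), ThornerZaman.condQn K ^ c₁ ≤ x →
            |(primeIdealClassCount K C x : ℝ) -
                (offsetLogIntegral x - ((χ₁ C : ℂ)).re * offsetLogIntegral (x ^ β₁)) /
                  NumberField.classNumber K| ≤
              ε * offsetLogIntegral x / NumberField.classNumber K) := by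
  obtain ⟨c₁, hc₁, h⟩ := classPNTAdditive_eps_of_kappa_local 3 (by norm_num) 10 hε
  exact ⟨c₁, hc₁, fun K _ _ hK ↦ h K hK (Residue.residueLowerBound_three K hK)⟩

/-- **`ε`-form for every QUADRATIC field (real or imaginary), unconditional.** -/
theorem classPNTAdditive_eps_quadratic {ε : ℝ} (hε : 0 < ε) :
    ∃ c₁ : ℝ, 0 < c₁ ∧ ∀ (K : Type) [Field K] [NumberField K], Module.finrank ℚ K = 2 →
      ((∀ (C : ClassGroup (𝓞 K)) (x : ℝ), ThornerZaman.condQn K ^ c₁ ≤ x →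
          |(primeIdealClassCount K C x : ℝ) - offsetLogIntegral x / NumberField.classNumber K| ≤
            ε * offsetLogIntegral x / NumberField.classNumber K) ∨
        ∃ (χ₁ : ClassGroup (𝓞 K) →* ℂˣ) (β₁ : ℝ), χ₁ * χ₁ = 1 ∧
          1 - 1 / (8 * Real.log (ThornerZaman.condQn K)) < β₁ ∧ β₁ < 1 ∧
          classGroupLFunction K χ₁ β₁ = 0 ∧
          ∀ (C : ClassGroup (𝓞 K)) (x : ℝ), ThornerZaman.condQn K ^ c₁ ≤ x →
            |(primeIdealClassCount K C x : ℝ) -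
                (offsetLogIntegral x - ((χ₁ C : ℂ)).re * offsetLogIntegral (x ^ β₁)) /
                  NumberField.classNumber K| ≤
              ε * offsetLogIntegral x / NumberField.classNumber K) := by
  obtain ⟨c₁, hc₁, h⟩ := classPNTAdditive_eps_of_kappa_local 2 (by norm_num) 1 hε
  exact ⟨c₁, hc₁, fun K _ _ hK ↦
    h K hK (Quadratic.condQn_rpow_neg_one_le_residue_of_finrank_eq_two (K := K) hK)⟩

/-- **`ε`-form for the fields of degree `n > 1` WITHOUT quadratic subfield, unconditional.** -/
theorem classPNTAdditive_eps_of_noQuadraticSubfield (n : ℕ) (hn : 1 < n) {ε : ℝ} (hε : 0 < ε) :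
    ∃ c₁ : ℝ, 0 < c₁ ∧ ∀ (K : Type) [Field K] [NumberField K], Module.finrank ℚ K = n →
      (∀ F : IntermediateField ℚ K, Module.finrank ℚ F ≠ 2) →
      ((∀ (C : ClassGroup (𝓞 K)) (x : ℝ), ThornerZaman.condQn K ^ c₁ ≤ x →
          |(primeIdealClassCount K C x : ℝ) - offsetLogIntegral x / NumberField.classNumber K| ≤
            ε * offsetLogIntegral x / NumberField.classNumber K) ∨
        ∃ (χ₁ : ClassGroup (𝓞 K) →* ℂˣ) (β₁ : ℝ), χ₁ * χ₁ = 1 ∧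
          1 - 1 / (8 * Real.log (ThornerZaman.condQn K)) < β₁ ∧ β₁ < 1 ∧
          classGroupLFunction K χ₁ β₁ = 0 ∧
          ∀ (C : ClassGroup (𝓞 K)) (x : ℝ), ThornerZaman.condQn K ^ c₁ ≤ x →
            |(primeIdealClassCount K C x : ℝ) -
                (offsetLogIntegral x - ((χ₁ C : ℂ)).re * offsetLogIntegral (x ^ β₁)) /
                  NumberField.classNumber K| ≤
              ε * offsetLogIntegral x / NumberField.classNumber K) := by
  obtain ⟨c₁, hc₁, h⟩ := classPNTAdditive_eps_of_kappa_local n hn 10 hε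
  exact ⟨c₁, hc₁, fun K _ _ hK hnq ↦
    h K hK (Residue.condQn_rpow_neg_ten_le_residue K (by rw [hK]; exact hn) hnq)⟩

/-- **`ε`-form for every number field of degree `2` or `3`, unconditional** (one constant per degree). -/
theorem classPNTAdditive_eps_of_le_three (n : ℕ) (hn : 1 < n) (hn3 : n ≤ 3) {ε : ℝ} (hε : 0 < ε) :
    ∃ c₁ : ℝ, 0 < c₁ ∧ ∀ (K : Type) [Field K] [NumberField K], Module.finrank ℚ K = n →
      ((∀ (C : ClassGroup (𝓞 K)) (x : ℝ), ThornerZaman.condQn K ^ c₁ ≤ x →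
          |(primeIdealClassCount K C x : ℝ) - offsetLogIntegral x / NumberField.classNumber K| ≤
            ε * offsetLogIntegral x / NumberField.classNumber K) ∨
        ∃ (χ₁ : ClassGroup (𝓞 K) →* ℂˣ) (β₁ : ℝ), χ₁ * χ₁ = 1 ∧
          1 - 1 / (8 * Real.log (ThornerZaman.condQn K)) < β₁ ∧ β₁ < 1 ∧
          classGroupLFunction K χ₁ β₁ = 0 ∧
          ∀ (C : ClassGroup (𝓞 K)) (x : ℝ), ThornerZaman.condQn K ^ c₁ ≤ x →
            |(primeIdealClassCount K C x : ℝ) -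
                (offsetLogIntegral x - ((χ₁ C : ℂ)).re * offsetLogIntegral (x ^ β₁)) /
                  NumberField.classNumber K| ≤
              ε * offsetLogIntegral x / NumberField.classNumber K) := by
  interval_cases n
  · exact classPNTAdditive_eps_quadratic hε
  · exact classPNTAdditive_eps_three hε

end Summit.QuantumAdvantage.QuantumAdvantage.Theorems.DegreeOnePrimesEscape

end
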